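import Summits.KontsevichZagierPeriods.Zeta5Search.Certificates.RayKernelNatB
import Literature.NumberTheory.Transcendental.ZudilinLemma19
import HarnessLib

/-!
# ζ(5) search — certificates: the GENERIC big-prime divisibility certificate for the kernel multiplier (TYPER g16)

HONEST FRAMING: systematic search; no irrationality claim unless certified.  Valuation bookkeeping of explicit rationals;
nothing here is a statement about `ζ(5)`.

OUR work (Summit side; typer seat, generation 16).  Sequel of `Certificates/RayKernelMultiplier`, `RayKernelNatB`.  On a
"big prime" `p` of a dual pair `(b, b′)` — `p² > b₀ + 2`, `p ≤ b₀` (so `v_p(d_{b₀}) = 1`), `p` above the block lengths of the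
normaliser (so `N♯(b)`, `N♯(b′)` are `p`-units from above) — the per-prime floors of the tree for the three coefficients
(`W`, `U` `p`-integral with `v_p(W) ≥ e_W`, `v_p(V) ≥ −N_p`: THEOREM V `constantTermFloorLaw_window` and the big-prime window
theorems of `BigPrimeWindow` / `ValuationLawsWindow`, supplied per ray) add up to a divisibility certificate for the integer
numerators `wedgeNumZ`, `qNumZ` of the kernel multiplier:

* `padicValRat_dOf0_eq_one` — `v_p(d_{b₀}) = 1` for `p ≤ b₀ < p²`;
* `padicValRat_sharpNormaliser_nonneg_of_lt` — `v_p(N♯(b)) ≥ 0` once `p > b₂`, `p > b₃` (the denominator `b₂! b₃!` is `p`-free);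
* **`bigPrime_cert`** — with `v_p(d) = 1`, `v_p(N♯) ≥ 0` at `b` and `b′`, floors `e_W, e_W′` for `W`, `0` for `U`, `−N, −N′` for
  `V`, every `k ≤ 9 + e_{W′} − N`, `k ≤ 9 + e_W − N′`, `k ≤ 9 + e_W`, `k ≤ 9 + e_{W′}` gives `p^k ∣ wedgeNumZ b b′` and
  `p^k ∣ qNumZ b b′` (the input format of `RayKernel.atlas_ints`).
-/

noncomputable section

open Finset

namespace Summit.KontsevichZagierPeriods.Zeta5Search.RayKernel

open Summit.KontsevichZagierPeriods.Zeta5Search.DualSeries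
open Summit.KontsevichZagierPeriods.Zeta5Search.DualSeriesDenominators
open Summit.KontsevichZagierPeriods.Zeta5Search.WedgeDictionary

variable {b b' : ℕ → ℤ} {p : ℕ} [hp : Fact p.Prime]

/-- `v_p(d_{b₀}) = 1` for `p ≤ b₀ < p²`. -/
theorem padicValRat_dOf0_eq_one (h1 : p ≤ bn b 0) (h2 : bn b 0 < p ^ 2) : padicValRat p (dOf0 b) = 1 := by
  unfold dOf0
  rw [padicValRat.of_nat]
  exact_mod_cast Literature.NumberTheory.Transcendental.Zudilin2004.padicValNat_lcmUpto_eq_one h1 h2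

/-- `v_p(m!) = 0` for `m < p` (as a rational valuation). -/
theorem padicValRat_natFactorial_eq_zero {m : ℕ} (h : m < p) : padicValRat p ((m.factorial : ℕ) : ℚ) = 0 := by
  rw [padicValRat.of_nat]
  have : ¬ p ∣ m.factorial := fun hd => absurd (hp.out.dvd_factorial.1 hd) (not_le.2 h)
  exact_mod_cast padicValNat.eq_zero_of_not_dvd this

/-- `v_p(N♯(b)) ≥ 0` once `p > b₂` and `p > b₃`: `N(b)` is a natural number and the denominator `b₂!·b₃!` is `p`-free. -/
theorem padicValRat_sharpNormaliser_nonneg_of_lt (h2 : bn b 2 < p) (h3 : bn b 3 < p) :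
    0 ≤ padicValRat p (sharpNormaliser b) := by
  have hN : ((normaliser b : ℕ) : ℚ) ≠ 0 := by
    have : 0 < normaliser b := by unfold normaliser; exact prod_pos fun s _ => Nat.factorial_pos _
    exact_mod_cast this.ne'
  have hF : ∀ m : ℕ, ((m.factorial : ℕ) : ℚ) ≠ 0 := fun m => by exact_mod_cast (Nat.factorial_pos m).ne'
  unfold sharpNormaliser
  rw [padicValRat.div hN (mul_ne_zero (hF _) (hF _)), padicValRat.mul (hF _) (hF _),
    padicValRat_natFactorial_eq_zero h2, padicValRat_natFactorial_eq_zero h3, padicValRat.of_nat]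
  simp

/-- **The big-prime certificate.**  At a prime `p` with `v_p(d_{b₀}) = 1` (`d` of `b`; the partner has the same `b₀`),
`v_p(N♯(b)), v_p(N♯(b′)) ≥ 0`, floors `v_p(W(b)) ≥ e_W`, `v_p(W(b′)) ≥ e_{W′}`, `v_p(U) ≥ 0` at `b, b′`, `v_p(V(b)) ≥ −N`,
`v_p(V(b′)) ≥ −N′` (each only when the coefficient is nonzero), every natural `k` with `k ≤ 9 + e_{W′} − N`,
`k ≤ 9 + e_W − N′`, `k ≤ 9 + e_W`, `k ≤ 9 + e_{W′}` satisfies `p^k ∣ wedgeNumZ b b′` and `p^k ∣ qNumZ b b′`. -/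
theorem bigPrime_cert (hb : SharpAdmissible b) (hb' : SharpAdmissible b') (h0 : bn b' 0 = bn b 0) {k : ℕ}
    {eW eW' N N' : ℤ} (hd : padicValRat p (dOf0 b) = 1)
    (hN : 0 ≤ padicValRat p (sharpNormaliser b)) (hN' : 0 ≤ padicValRat p (sharpNormaliser b'))
    (hW : coeffW b ≠ 0 → eW ≤ padicValRat p (coeffW b)) (hW' : coeffW b' ≠ 0 → eW' ≤ padicValRat p (coeffW b'))
    (hU : coeffU b ≠ 0 → 0 ≤ padicValRat p (coeffU b)) (hU' : coeffU b' ≠ 0 → 0 ≤ padicValRat p (coeffU b'))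
    (hV : coeffV b ≠ 0 → -N ≤ padicValRat p (coeffV b)) (hV' : coeffV b' ≠ 0 → -N' ≤ padicValRat p (coeffV b'))
    (hk1 : (k : ℤ) ≤ 9 + eW' - N) (hk2 : (k : ℤ) ≤ 9 + eW - N') (hk3 : (k : ℤ) ≤ 9 + eW) (hk4 : (k : ℤ) ≤ 9 + eW') :
    (p : ℤ) ^ k ∣ wedgeNumZ b b' ∧ (p : ℤ) ^ k ∣ qNumZ b b' := by
  have hd' : padicValRat p (dOf0 b') = 1 := by unfold dOf0 at hd ⊢; rw [h0]; exact hd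
  constructor
  · refine pow_dvd_wedgeNumZ_of_val hb hb' (fun hW'0 hV0 => ?_) (fun hW0 hV'0 => ?_)
    · rw [padicValRat_zW hW'0, padicValRat_zV hV0, hd, hd']
      have := hW' hW'0; have := hV hV0
      linarith
    · rw [padicValRat_zW hW0, padicValRat_zV hV'0, hd, hd']
      have := hW hW0; have := hV' hV'0
      linarith
  · refine pow_dvd_qNumZ_of_val hb hb' (fun hU0 hW'0 => ?_) (fun hU'0 hW0 => ?_)
    · rw [padicValRat_zU hU0, padicValRat_zW hW'0, hd, hd']
      have := hU hU0; have := hW' hW'0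
      linarith
    · rw [padicValRat_zU hU'0, padicValRat_zW hW0, hd, hd']
      have := hU' hU'0; have := hW hW0
      linarith

end Summit.KontsevichZagierPeriods.Zeta5Search.RayKernel
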